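import Literature.NumberTheory.Sieve.SmoothArcClassUniformityFree
import Mathlib.Data.Nat.Factorization.Basic
import HarnessLib

/-!
# Class uniformity fibrewise in the unit `a`

Topic `Literature/NumberTheory/Sieve`; a PROVED algebraic tool file continuing `SmoothArcClassUniformity` and
`SmoothArcClassUniformityFree` (generic finite exponential-sum algebra behind [MontgomeryVaughanActa1975, §5–6] and
[Harper2016, §2.2, §5]). Notation: `classWeightedSum W m r k h = Σ_{t mod L, t ≡ r (m)} e(ht/k) W((t, L))`,
`L = lcm(k, m)`, `C_g(h) = classGcdSum m r k h g`, `c_n(h)` = `ramanujanSum n h`; `q` is an odd prime, `k = q^j k'`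
with `q ∤ k'`, `u₁k' ≡ 1 (mod q^j)`, `u₂q^j ≡ 1 (mod k')` are CRT units, and the FIBRE of a residue `a₂` is
`{a < k : (a, k) = 1, a ≡ a₂ (mod k')}` (by CRT `↔ {a₁ mod q^j : q ∤ a₁}` if `(a₂, k') = 1`, empty otherwise).

* `sum_coprime_modEq_eq_mul_of_periodic`: CRT for sums over the units of ONE fibre.
* `classWeightedSum_two_mul_eq_mul` (the factorisation behind everything): for a unit class `t (mod 2q)`,
  `classWeightedSum W (2q) t k h = classWeightedSum 1 q t (q^j) (hu₁) · classWeightedSum W 2 1 k' (hu₂)` — the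
  level-`k'` factor only remembers the parity of the class and depends on `h` only mod `k'`.
* **Fibrewise class uniformity** (`sum_fibre_classWeightedSum_mul_eq_moebius_mul`, `…_mul_eq`, `…_mul_eq_zero`): for
  `v ≥ 1`, `q ∤ D₂`, ARBITRARY weights `W₁, W₂`, `D₁ ∈ ℤ`, unit classes `r, s (mod 2q)` and EVERY residue `a₂`:
  `Σ_{a in the fibre of a₂} classWeightedSum W₁ (2q) r k (D₁q^v a) · classWeightedSum W₂ (2q) s k (D₂a)`
  `= μ(q^j) · [(k', a₂) = 1] · classWeightedSum W₁ 2 1 k' (D₁q^v u₂a₂) · classWeightedSum W₂ 2 1 k' (D₂u₂a₂)`,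
  independent of `(r, s)`, and `0` when `q² ∣ k`; summed over `a₂ mod k'` this is the closed form of
  `SmoothArcClassUniformity`. (For `j = 0` the fibre is the single unit `a₂`: the statement is pointwise; for `j ≥ 2`
  every summand vanishes by `classWeightedSum_eq_zero_of_sq_dvd_of_coprime`, so there any set of units will do.)
* Unions of fibres (`sum_filter_coprime_eq_of_fibres`): the same over `{a < k : (a,k)=1, P(a)}` for any `k'`-periodic
  predicate `P`; with `k ≥ 1` arbitrary and `k' = k/q^{v_q(k)}` (`…_of_periodic` versions).
* **A third factor with modulus prime to `q`** (`classWeightedSum_mul_natCast_eq_of_modEq`): for `q ∤ m` (a FREE factor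
  `m = 1`, a PARITY-ONLY factor `m = 2`, …), units `a ≡ a' (mod k')` and every `D₃ ∈ ℤ`, `W₃`, `r₃`:
  `classWeightedSum W₃ m r₃ k (D₃a) = classWeightedSum W₃ m r₃ k (D₃a')` — in the divisor form `Σ_g C_g(D₃a) W₃(g)`
  each `C_g` factors by CRT (`classGcdSum_mul_of_coprime'`) into `c_{q^j/g₁}(D₃au₁) = c_{q^j/g₁}(D₃u₁)` (Kluyver) and
  a function of `a mod k'`. Hence the fibre sums of the TRIPLE products
  `classWeightedSum W₁ (2q) r k (D₁q^v a) · classWeightedSum W₂ (2q) s k (D₂a) · classWeightedSum W₃ m r₃ k (D₃a)` are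
  `(r, s)`-independent as well (`sum_fibre_classWeightedSum_mul_mul_eq`, `…_one_eq`, `…_two_eq`) and vanish for
  `q² ∣ k` (`sum_filter_coprime_mul_classWeightedSum_eq_zero`, `sum_filter_coprime_mul_classWeightedSum_mul_eq_zero`).

In the circle method for `d₁n₁ ± d₂n₂ = d₃n₃` in friable integers with `n₁, n₂` in unit classes mod `2q` and `q ∣ N₀`, the
weights met on the major arc at `a/k` are functions of the fibre of `a`; these identities make the pure-principal part
class-independent fibre by fibre. Conjugated factors are covered through `conj_classWeightedSum` (`D ↦ −D`).

## References

* H. L. Montgomery, R. C. Vaughan, Acta Arith. 27 (1975), §5–6 [MontgomeryVaughanActa1975].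
* A. J. Harper, Compositio Math. 152 (2016), §2.2, §5 [Harper2016].
-/

noncomputable section

open Finset Real Complex
open scoped ArithmeticFunction.Moebius FourierTransform

namespace Literature.NumberTheory.Sieve

namespace SmoothArcs

/-! ### CRT on one fibre -/

/-- **CRT for sums over the units of one fibre.** For coprime `k₁, k₂ ≥ 1`, `F = f·g` with `f` (`g`) depending on
`a` only mod `k₁` (mod `k₂`), and a residue `a₂`:
`Σ_{a < k₁k₂, (a,k₁k₂)=1, a ≡ a₂ (k₂)} F(a) = (Σ_{a₁ < k₁, (a₁,k₁)=1} f(a₁)) · [(k₂, a₂) = 1] g(a₂)`. [folklore] -/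
theorem sum_coprime_modEq_eq_mul_of_periodic {k₁ k₂ : ℕ} (hk : k₁.Coprime k₂) (hk₁ : k₁ ≠ 0) (hk₂ : k₂ ≠ 0)
    {F f g : ℕ → ℂ} (hF : ∀ a, F a = f a * g a) (hf : ∀ a b, a ≡ b [MOD k₁] → f a = f b)
    (hg : ∀ a b, a ≡ b [MOD k₂] → g a = g b) (a₂ : ℕ) :
    ∑ a ∈ (Finset.range (k₁ * k₂)).filter (fun a => Nat.Coprime (k₁ * k₂) a ∧ a ≡ a₂ [MOD k₂]), F a =
      (∑ a ∈ (Finset.range k₁).filter (Nat.Coprime k₁), f a) * (if Nat.Coprime k₂ a₂ then g a₂ else 0) := by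
  have hmod : ∀ n a : ℕ, Nat.Coprime n a ↔ Nat.Coprime n (a % n) := fun n a => by
    unfold Nat.Coprime; rw [Nat.gcd_rec n a, Nat.gcd_comm (a % n) n]
  have key : ∑ a ∈ (Finset.range (k₁ * k₂)).filter (Nat.Coprime (k₁ * k₂)), (if a ≡ a₂ [MOD k₂] then F a else 0) =
      (∑ a ∈ (Finset.range k₁).filter (Nat.Coprime k₁), f a) *
        ∑ a ∈ (Finset.range k₂).filter (Nat.Coprime k₂), (if a ≡ a₂ [MOD k₂] then g a else 0) :=
    sum_coprime_eq_mul_of_periodic hk hk₁ hk₂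
      (fun a => by
        by_cases h : a ≡ a₂ [MOD k₂]
        · rw [if_pos h, if_pos h, hF a]
        · rw [if_neg h, if_neg h, mul_zero])
      hf
      (fun a b hab => by
        by_cases h : a ≡ a₂ [MOD k₂]
        · rw [if_pos h, if_pos (hab.symm.trans h), hg a b hab]
        · rw [if_neg h, if_neg fun h' => h (hab.trans h')])
  have hfilter : (Finset.range (k₁ * k₂)).filter (fun a => Nat.Coprime (k₁ * k₂) a ∧ a ≡ a₂ [MOD k₂]) =
      ((Finset.range (k₁ * k₂)).filter (Nat.Coprime (k₁ * k₂))).filter (fun a => a ≡ a₂ [MOD k₂]) :=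
    (Finset.filter_filter _ _ _).symm
  rw [hfilter, Finset.sum_filter, key]
  congr 1
  by_cases hc : Nat.Coprime k₂ a₂
  · have hmem : a₂ % k₂ ∈ (Finset.range k₂).filter (Nat.Coprime k₂) :=
      Finset.mem_filter.mpr ⟨Finset.mem_range.mpr (Nat.mod_lt a₂ (Nat.pos_of_ne_zero hk₂)), (hmod k₂ a₂).mp hc⟩
    rw [if_pos hc, Finset.sum_eq_single_of_mem (a₂ % k₂) hmem fun b hb hne => if_neg fun hba => hne ?_,
      if_pos (Nat.mod_modEq a₂ k₂), hg _ _ (Nat.mod_modEq a₂ k₂)]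
    rw [← Nat.mod_eq_of_lt (Finset.mem_range.mp (Finset.mem_filter.mp hb).1)]
    exact hba
  · rw [if_neg hc]
    refine Finset.sum_eq_zero fun b hb => if_neg fun hba => hc ?_
    exact Nat.Coprime.symm (by rw [Nat.Coprime, ← hba.gcd_eq]; exact (Finset.mem_filter.mp hb).2.symm)

/-- **Unions of fibres.** If two functions have the same sum over every fibre `{a < k : (a,k)=1, a ≡ b (mod k')}`,
they have the same sum over `{a < k : (a,k)=1, P(a)}` for every `k'`-periodic predicate `P` (`k' ≥ 1`). [folklore] -/
theorem sum_filter_coprime_eq_of_fibres {k k' : ℕ} (hk' : k' ≠ 0) (P : ℕ → Prop) [DecidablePred P]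
    (hP : ∀ a b, a ≡ b [MOD k'] → (P a ↔ P b)) {F G : ℕ → ℂ}
    (h : ∀ b, ∑ a ∈ (Finset.range k).filter (fun a => Nat.Coprime k a ∧ a ≡ b [MOD k']), F a =
      ∑ a ∈ (Finset.range k).filter (fun a => Nat.Coprime k a ∧ a ≡ b [MOD k']), G a) :
    ∑ a ∈ (Finset.range k).filter (fun a => Nat.Coprime k a ∧ P a), F a =
      ∑ a ∈ (Finset.range k).filter (fun a => Nat.Coprime k a ∧ P a), G a := by
  have hmaps : ∀ a ∈ (Finset.range k).filter (fun a => Nat.Coprime k a ∧ P a), a % k' ∈ Finset.range k' :=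
    fun a _ => Finset.mem_range.mpr (Nat.mod_lt a (Nat.pos_of_ne_zero hk'))
  rw [← Finset.sum_fiberwise_of_maps_to hmaps F, ← Finset.sum_fiberwise_of_maps_to hmaps G]
  refine Finset.sum_congr rfl fun b hb => ?_
  have hbk : b % k' = b := Nat.mod_eq_of_lt (Finset.mem_range.mp hb)
  have hfilt : ((Finset.range k).filter (fun a => Nat.Coprime k a ∧ P a)).filter (fun a => a % k' = b) =
      ((Finset.range k).filter (fun a => Nat.Coprime k a ∧ a ≡ b [MOD k'])).filter (fun _ => P b) := by
    ext a
    simp only [Finset.mem_filter, Nat.ModEq, hbk]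
    constructor
    · rintro ⟨⟨hak, hcop, hPa⟩, hab⟩
      exact ⟨⟨hak, hcop, hab⟩, (hP a b (show a % k' = b % k' by rw [hab, hbk])).mp hPa⟩
    · rintro ⟨⟨hak, hcop, hab⟩, hPb⟩
      exact ⟨⟨hak, hcop, (hP a b (show a % k' = b % k' by rw [hab, hbk])).mpr hPb⟩, hab⟩
  rw [hfilt]
  by_cases hPb : P b
  · rw [Finset.filter_true_of_mem fun _ _ => hPb, h b]
  · rw [Finset.filter_false_of_mem fun _ _ => hPb, Finset.sum_empty, Finset.sum_empty]

/-- Sums of `F·G` and `F'·G` over `T` agree when `G` is constant on `T` and `Σ_T F = Σ_T F'`. [folklore] -/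
theorem sum_mul_eq_sum_mul_of_const {T : Finset ℕ} {F F' : ℕ → ℂ} (G : ℕ → ℂ) {c : ℂ} (hG : ∀ a ∈ T, G a = c)
    (h : ∑ a ∈ T, F a = ∑ a ∈ T, F' a) : ∑ a ∈ T, F a * G a = ∑ a ∈ T, F' a * G a := by
  have e : ∀ Φ : ℕ → ℂ, ∑ a ∈ T, Φ a * G a = (∑ a ∈ T, Φ a) * c := fun Φ => by
    rw [Finset.sum_mul]; exact Finset.sum_congr rfl fun a ha => by rw [hG a ha]
  rw [e, e, h]

/-! ### The factorisation of one class-restricted factor -/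

/-- **CRT factorisation of a class-restricted factor.** For an odd prime `q`, `k = q^j k'` with `q ∤ k'`, `k' ≥ 1`,
`u₁k' ≡ 1 (mod q^j)`, `u₂q^j ≡ 1 (mod k')` and a unit class `t (mod 2q)`:
`classWeightedSum W (2q) t k h = classWeightedSum 1 q t (q^j) (hu₁) · classWeightedSum W 2 1 k' (hu₂)`
(`classWeightedSum_mul_of_coprime_of_unit`; the class mod `2` of an odd `t` is `1`). [folklore] -/
theorem classWeightedSum_two_mul_eq_mul {q : ℕ} (hq : q.Prime) (hq2 : q ≠ 2) {j k' : ℕ} (hk' : k' ≠ 0)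
    (hqk' : ¬ q ∣ k') {u₁ u₂ : ℤ} (hu₁ : u₁ * k' ≡ 1 [ZMOD (q ^ j : ℕ)]) (hu₂ : u₂ * (q ^ j : ℕ) ≡ 1 [ZMOD k'])
    (W : ℕ → ℂ) {t : ℕ} (ht : t.Coprime (2 * q)) (h : ℤ) :
    classWeightedSum W (2 * q) t (q ^ j * k') h =
      classWeightedSum 1 q t (q ^ j) (h * u₁) * classWeightedSum W 2 1 k' (h * u₂) := by
  have ht2 : ¬ 2 ∣ t := fun h2 => by have := Nat.eq_one_of_dvd_coprimes ht h2 (dvd_mul_right 2 q); omega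
  have ht1 : t ≡ 1 [MOD 2] := by unfold Nat.ModEq; omega
  rw [mul_comm 2 q, classWeightedSum_mul_of_coprime_of_unit W (pow_ne_zero j hq.ne_zero) hk' hq.ne_zero two_ne_zero
      (coprime_pow_mul_self_mul_two hq hq2 hqk' j) (coprime_lcm_pow_of_modEq j (ht.coprime_dvd_right (dvd_mul_left q 2)))
      hu₁ hu₂, classWeightedSum_congr_class W ht1]

/-- … with the numerator `h = ca`: `classWeightedSum W (2q) t k (ca) = classWeightedSum 1 q t (q^j) (cu₁a) ·
classWeightedSum W 2 1 k' (cu₂a)`. [folklore] -/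
theorem classWeightedSum_two_mul_natCast_eq_mul {q : ℕ} (hq : q.Prime) (hq2 : q ≠ 2) {j k' : ℕ} (hk' : k' ≠ 0)
    (hqk' : ¬ q ∣ k') {u₁ u₂ : ℤ} (hu₁ : u₁ * k' ≡ 1 [ZMOD (q ^ j : ℕ)]) (hu₂ : u₂ * (q ^ j : ℕ) ≡ 1 [ZMOD k'])
    (W : ℕ → ℂ) {t : ℕ} (ht : t.Coprime (2 * q)) (c : ℤ) (a : ℕ) :
    classWeightedSum W (2 * q) t (q ^ j * k') (c * a) =
      classWeightedSum 1 q t (q ^ j) (c * u₁ * a) * classWeightedSum W 2 1 k' (c * u₂ * a) := by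
  rw [classWeightedSum_two_mul_eq_mul hq hq2 hk' hqk' hu₁ hu₂ W ht, mul_right_comm c (a : ℤ) u₁,
    mul_right_comm c (a : ℤ) u₂]

/-! ### Fibrewise class uniformity -/

/-- **Fibrewise class uniformity, closed form.** For an odd prime `q`, `k = q^j k'` with `q ∤ k'`, `k' ≥ 1`,
`u₂q^j ≡ 1 (mod k')`, `v ≥ 1`, `q ∤ D₂`, any `D₁ ∈ ℤ`, ARBITRARY weights `W₁, W₂`, unit classes `r, s (mod 2q)` and
any residue `a₂`:
`Σ_{a < k, (a,k)=1, a ≡ a₂ (k')} classWeightedSum W₁ (2q) r k (D₁q^v a) · classWeightedSum W₂ (2q) s k (D₂a)`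
`= μ(q^j) · [(k', a₂) = 1] · classWeightedSum W₁ 2 1 k' (D₁q^v u₂a₂) · classWeightedSum W₂ 2 1 k' (D₂u₂a₂)`
— the right side does not mention `r, s`. [folklore] -/
theorem sum_fibre_classWeightedSum_mul_eq_moebius_mul {q : ℕ} (hq : q.Prime) (hq2 : q ≠ 2) {j k' : ℕ}
    (hk' : k' ≠ 0) (hqk' : ¬ q ∣ k') {u₂ : ℤ} (hu₂ : u₂ * (q ^ j : ℕ) ≡ 1 [ZMOD k']) {v : ℕ} (hv : 1 ≤ v)
    (D₁ : ℤ) {D₂ : ℤ} (hD₂ : ¬ (q : ℤ) ∣ D₂) (W₁ W₂ : ℕ → ℂ) {r s : ℕ} (hr : r.Coprime (2 * q))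
    (hs : s.Coprime (2 * q)) (a₂ : ℕ) :
    ∑ a ∈ (Finset.range (q ^ j * k')).filter (fun a => Nat.Coprime (q ^ j * k') a ∧ a ≡ a₂ [MOD k']),
        classWeightedSum W₁ (2 * q) r (q ^ j * k') (D₁ * q ^ v * a) *
          classWeightedSum W₂ (2 * q) s (q ^ j * k') (D₂ * a) =
      (μ (q ^ j) : ℂ) * if Nat.Coprime k' a₂ then
        classWeightedSum W₁ 2 1 k' (D₁ * q ^ v * u₂ * a₂) * classWeightedSum W₂ 2 1 k' (D₂ * u₂ * a₂) else 0 := by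
  have hqk : q.Coprime k' := (Nat.Prime.coprime_iff_not_dvd hq).mpr hqk'
  obtain ⟨u₁, -, hu₁, -⟩ := exists_crt_units (Nat.Coprime.pow_left j hqk)
  have hF : ∀ a : ℕ, classWeightedSum W₁ (2 * q) r (q ^ j * k') (D₁ * q ^ v * a) *
      classWeightedSum W₂ (2 * q) s (q ^ j * k') (D₂ * a) =
      classWeightedSum 1 q r (q ^ j) (D₁ * q ^ v * u₁ * a) * classWeightedSum 1 q s (q ^ j) (D₂ * u₁ * a) *
        (classWeightedSum W₁ 2 1 k' (D₁ * q ^ v * u₂ * a) * classWeightedSum W₂ 2 1 k' (D₂ * u₂ * a)) := by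
    intro a
    rw [classWeightedSum_two_mul_natCast_eq_mul hq hq2 hk' hqk' hu₁ hu₂ W₁ hr,
      classWeightedSum_two_mul_natCast_eq_mul hq hq2 hk' hqk' hu₁ hu₂ W₂ hs]
    ring
  have hmodz : ∀ {n a b : ℕ} (c : ℤ), a ≡ b [MOD n] → c * a ≡ c * b [ZMOD n] := fun c hab =>
    Int.ModEq.mul_left c (Int.natCast_modEq_iff.mpr hab)
  have hc₁ : (q : ℤ) ∣ D₁ * q ^ v * u₁ :=
    dvd_mul_of_dvd_left (dvd_mul_of_dvd_right (dvd_pow_self (q : ℤ) (by omega)) D₁) u₁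
  rw [sum_coprime_modEq_eq_mul_of_periodic (Nat.Coprime.pow_left j hqk) (pow_ne_zero j hq.ne_zero) hk' hF
      (fun a b hab => by rw [classWeightedSum_congr_intModEq 1 q r (hmodz (D₁ * q ^ v * u₁) hab),
        classWeightedSum_congr_intModEq 1 q s (hmodz (D₂ * u₁) hab)])
      (fun a b hab => by rw [classWeightedSum_congr_intModEq W₁ 2 1 (hmodz (D₁ * q ^ v * u₂) hab),
        classWeightedSum_congr_intModEq W₂ 2 1 (hmodz (D₂ * u₂) hab)]) a₂,
    sum_coprime_classWeightedSum_one_mul_eq_moebius hq j r (hs.coprime_dvd_right (dvd_mul_left q 2)) hc₁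
      fun hj0 => not_dvd_mul_crt_unit hq hj0 hu₁ hD₂]

/-- **Fibrewise class uniformity.** For an odd prime `q`, `k = q^j k'` with `q ∤ k'`, `k' ≥ 1`, `v ≥ 1`, any
`D₁ ∈ ℤ`, `q ∤ D₂`, ARBITRARY weights `W₁, W₂ : ℕ → ℂ`, unit classes `r, s, r', s' (mod 2q)` and any residue `a₂`:
`Σ_{a < k, (a,k)=1, a ≡ a₂ (k')} classWeightedSum W₁ (2q) r k (D₁q^v a) · classWeightedSum W₂ (2q) s k (D₂a)` takes
the same value for `(r, s)` and `(r', s')` — summing over ONE fibre of `a ↦ a mod k'` already kills the dependence on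
the unit classes. [folklore] -/
theorem sum_fibre_classWeightedSum_mul_eq {q : ℕ} (hq : q.Prime) (hq2 : q ≠ 2) {j k' : ℕ} (hk' : k' ≠ 0)
    (hqk' : ¬ q ∣ k') {v : ℕ} (hv : 1 ≤ v) (D₁ : ℤ) {D₂ : ℤ} (hD₂ : ¬ (q : ℤ) ∣ D₂) (W₁ W₂ : ℕ → ℂ)
    {r s r' s' : ℕ} (hr : r.Coprime (2 * q)) (hs : s.Coprime (2 * q)) (hr' : r'.Coprime (2 * q))
    (hs' : s'.Coprime (2 * q)) (a₂ : ℕ) :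
    ∑ a ∈ (Finset.range (q ^ j * k')).filter (fun a => Nat.Coprime (q ^ j * k') a ∧ a ≡ a₂ [MOD k']),
        classWeightedSum W₁ (2 * q) r (q ^ j * k') (D₁ * q ^ v * a) *
          classWeightedSum W₂ (2 * q) s (q ^ j * k') (D₂ * a) =
      ∑ a ∈ (Finset.range (q ^ j * k')).filter (fun a => Nat.Coprime (q ^ j * k') a ∧ a ≡ a₂ [MOD k']),
        classWeightedSum W₁ (2 * q) r' (q ^ j * k') (D₁ * q ^ v * a) *
          classWeightedSum W₂ (2 * q) s' (q ^ j * k') (D₂ * a) := by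
  obtain ⟨-, u₂, -, hu₂⟩ := exists_crt_units (Nat.Coprime.pow_left j ((Nat.Prime.coprime_iff_not_dvd hq).mpr hqk'))
  rw [sum_fibre_classWeightedSum_mul_eq_moebius_mul hq hq2 hk' hqk' hu₂ hv D₁ hD₂ W₁ W₂ hr hs a₂,
    sum_fibre_classWeightedSum_mul_eq_moebius_mul hq hq2 hk' hqk' hu₂ hv D₁ hD₂ W₁ W₂ hr' hs' a₂]

/-- … and over any union of fibres `{a < k : (a,k)=1, P(a)}`, `P` a `k'`-periodic predicate. [folklore] -/
theorem sum_filter_coprime_classWeightedSum_mul_eq {q : ℕ} (hq : q.Prime) (hq2 : q ≠ 2) {j k' : ℕ} (hk' : k' ≠ 0)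
    (hqk' : ¬ q ∣ k') {v : ℕ} (hv : 1 ≤ v) (D₁ : ℤ) {D₂ : ℤ} (hD₂ : ¬ (q : ℤ) ∣ D₂) (W₁ W₂ : ℕ → ℂ)
    (P : ℕ → Prop) [DecidablePred P] (hP : ∀ a b, a ≡ b [MOD k'] → (P a ↔ P b)) {r s r' s' : ℕ}
    (hr : r.Coprime (2 * q)) (hs : s.Coprime (2 * q)) (hr' : r'.Coprime (2 * q)) (hs' : s'.Coprime (2 * q)) :
    ∑ a ∈ (Finset.range (q ^ j * k')).filter (fun a => Nat.Coprime (q ^ j * k') a ∧ P a),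
        classWeightedSum W₁ (2 * q) r (q ^ j * k') (D₁ * q ^ v * a) *
          classWeightedSum W₂ (2 * q) s (q ^ j * k') (D₂ * a) =
      ∑ a ∈ (Finset.range (q ^ j * k')).filter (fun a => Nat.Coprime (q ^ j * k') a ∧ P a),
        classWeightedSum W₁ (2 * q) r' (q ^ j * k') (D₁ * q ^ v * a) *
          classWeightedSum W₂ (2 * q) s' (q ^ j * k') (D₂ * a) :=
  sum_filter_coprime_eq_of_fibres hk' P hP fun b =>
    sum_fibre_classWeightedSum_mul_eq hq hq2 hk' hqk' hv D₁ hD₂ W₁ W₂ hr hs hr' hs' b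

/-- **Fibrewise class uniformity, arbitrary modulus.** For an odd prime `q`, `k ≥ 1`, `k' = k/q^{v_q(k)}`, `v ≥ 1`,
`q ∤ D₂`, unit classes mod `2q` and a `k'`-periodic predicate `P`:
`Σ_{a < k, (a,k)=1, P(a)} classWeightedSum W₁ (2q) r k (D₁q^v a) · classWeightedSum W₂ (2q) s k (D₂a)` does not depend
on `(r, s)`. [folklore] -/
theorem sum_filter_coprime_classWeightedSum_mul_eq_of_periodic {q : ℕ} (hq : q.Prime) (hq2 : q ≠ 2) {k : ℕ}
    (hk : k ≠ 0) {v : ℕ} (hv : 1 ≤ v) (D₁ : ℤ) {D₂ : ℤ} (hD₂ : ¬ (q : ℤ) ∣ D₂) (W₁ W₂ : ℕ → ℂ)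
    (P : ℕ → Prop) [DecidablePred P] (hP : ∀ a b, a ≡ b [MOD k / q ^ k.factorization q] → (P a ↔ P b))
    {r s r' s' : ℕ} (hr : r.Coprime (2 * q)) (hs : s.Coprime (2 * q)) (hr' : r'.Coprime (2 * q))
    (hs' : s'.Coprime (2 * q)) :
    ∑ a ∈ (Finset.range k).filter (fun a => Nat.Coprime k a ∧ P a),
        classWeightedSum W₁ (2 * q) r k (D₁ * q ^ v * a) * classWeightedSum W₂ (2 * q) s k (D₂ * a) =
      ∑ a ∈ (Finset.range k).filter (fun a => Nat.Coprime k a ∧ P a),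
        classWeightedSum W₁ (2 * q) r' k (D₁ * q ^ v * a) * classWeightedSum W₂ (2 * q) s' k (D₂ * a) := by
  have e : q ^ k.factorization q * (k / q ^ k.factorization q) = k := Nat.ordProj_mul_ordCompl_eq_self k q
  have hk' : k / q ^ k.factorization q ≠ 0 := fun h0 => hk (by rw [← e, h0, mul_zero])
  rw [← e]
  exact sum_filter_coprime_classWeightedSum_mul_eq hq hq2 hk' (Nat.not_dvd_ordCompl hq hk) hv D₁ hD₂ W₁ W₂ P hP
    hr hs hr' hs'

/-- **Vanishing for `q² ∣ k` over any set of units.** For an odd prime `q` with `q² ∣ k`, a class `s` prime to `q`,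
`q ∤ D₂` and ANY first factor `Φ`, weights `W₂` and predicate `P`:
`Σ_{a < k, (a,k)=1, P(a)} Φ(a) · classWeightedSum W₂ (2q) s k (D₂a) = 0` — every summand vanishes
(`classWeightedSum_eq_zero_of_sq_dvd_of_coprime`). [folklore] -/
theorem sum_filter_coprime_mul_classWeightedSum_eq_zero {q : ℕ} (hq : q.Prime) (hq2 : q ≠ 2) {k : ℕ}
    (hqk : q ^ 2 ∣ k) (Φ : ℕ → ℂ) {D₂ : ℤ} (hD₂ : ¬ (q : ℤ) ∣ D₂) (W₂ : ℕ → ℂ) (P : ℕ → Prop) [DecidablePred P]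
    {s : ℕ} (hs : s.Coprime (2 * q)) :
    ∑ a ∈ (Finset.range k).filter (fun a => Nat.Coprime k a ∧ P a), Φ a * classWeightedSum W₂ (2 * q) s k (D₂ * a) = 0 := by
  refine Finset.sum_eq_zero fun a ha => ?_
  rw [classWeightedSum_eq_zero_of_sq_dvd_of_coprime hq hq2 hqk (hs.coprime_dvd_right (dvd_mul_left q 2)) hD₂
    (Finset.mem_filter.mp ha).2.1 W₂, mul_zero]

/-- In particular the fibre sums of `sum_fibre_classWeightedSum_mul_eq` vanish for `j ≥ 2`. [folklore] -/
theorem sum_fibre_classWeightedSum_mul_eq_zero {q : ℕ} (hq : q.Prime) (hq2 : q ≠ 2) {j : ℕ} (hj : 2 ≤ j) (k' : ℕ)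
    (c₁ : ℤ) {D₂ : ℤ} (hD₂ : ¬ (q : ℤ) ∣ D₂) (W₁ W₂ : ℕ → ℂ) (r : ℕ) {s : ℕ} (hs : s.Coprime (2 * q)) (a₂ : ℕ) :
    ∑ a ∈ (Finset.range (q ^ j * k')).filter (fun a => Nat.Coprime (q ^ j * k') a ∧ a ≡ a₂ [MOD k']),
        classWeightedSum W₁ (2 * q) r (q ^ j * k') (c₁ * a) * classWeightedSum W₂ (2 * q) s (q ^ j * k') (D₂ * a) = 0 :=
  sum_filter_coprime_mul_classWeightedSum_eq_zero hq hq2 (dvd_mul_of_dvd_left (pow_dvd_pow q hj) k') _ hD₂ W₂ _ hs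

/-! ### A third factor whose modulus is prime to `q` -/

/-- `C_g(h)` depends on `h` only through `h mod k`. [folklore] -/
theorem classGcdSum_congr_intModEq (m r : ℕ) {k : ℕ} {h h' : ℤ} (hh : h ≡ h' [ZMOD k]) (g : ℕ) :
    classGcdSum m r k h g = classGcdSum m r k h' g :=
  Finset.sum_congr rfl fun t _ => by rw [fourierChar_mul_div_eq_of_intModEq hh t]

/-- **A factor with modulus prime to `k₁` is constant on the fibres mod `k₂`.** For `k₁, k₂ ≥ 1`, `(k₁, k₂m) = 1`,
any weights `W`, class `r (mod m)`, `D ∈ ℤ`, and `a, b` prime to `k₁` with `a ≡ b (mod k₂)`: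
`classWeightedSum W m r (k₁k₂) (Da) = classWeightedSum W m r (k₁k₂) (Db)`: in `Σ_g C_g W(g)` each
`C_g(Da) = c_{k₁/g₁}(Dau₁) · C_{g₂}(Dau₂; m, r, k₂)` (`classGcdSum_mul_of_coprime'`, `classGcdSum_one`) with
`c_{k₁/g₁}(Dau₁) = c_{k₁/g₁}(Du₁)` (Kluyver, `ramanujanSum_mul_natCast_of_coprime`) and the second factor a
function of `a mod k₂`. [folklore] -/
theorem classWeightedSum_mul_natCast_eq_of_modEq {k₁ k₂ m : ℕ} (hk₁ : k₁ ≠ 0) (hk₂ : k₂ ≠ 0)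
    (hc : k₁.Coprime (k₂ * m)) (W : ℕ → ℂ) (r : ℕ) (D : ℤ) {a b : ℕ} (ha : k₁.Coprime a) (hb : k₁.Coprime b)
    (hab : a ≡ b [MOD k₂]) :
    classWeightedSum W m r (k₁ * k₂) (D * a) = classWeightedSum W m r (k₁ * k₂) (D * b) := by
  rcases eq_or_ne m 0 with rfl | hm
  · simp [classWeightedSum]
  have hc' : (k₁ * 1).Coprime (k₂ * m) := by rwa [mul_one]
  obtain ⟨u₁, u₂, hu₁, hu₂⟩ := exists_crt_units (hc.coprime_dvd_right (dvd_mul_right k₂ m))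
  rw [classWeightedSum_eq_sum_divisors, classWeightedSum_eq_sum_divisors]
  refine Finset.sum_congr rfl fun g hg => ?_
  have hgL : g ∣ Nat.lcm (k₁ * k₂) (1 * m) := by rw [one_mul]; exact Nat.dvd_of_mem_divisors hg
  have e : ∀ h : ℤ, classGcdSum m r (k₁ * k₂) h g = classGcdSum 1 r k₁ (h * u₁) (Nat.gcd g (Nat.lcm k₁ 1)) *
      classGcdSum m r k₂ (h * u₂) (Nat.gcd g (Nat.lcm k₂ m)) := fun h => by
    have e1 := classGcdSum_mul_of_coprime' hk₁ hk₂ one_ne_zero hm hc' r (h := h) hu₁ hu₂ hgL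
    rwa [one_mul] at e1
  have hg₁ : Nat.gcd g (Nat.lcm k₁ 1) ∣ k₁ := by rw [Nat.lcm_one_right]; exact Nat.gcd_dvd_right g k₁
  have hram : ∀ {c : ℕ}, k₁.Coprime c → ramanujanSum (k₁ / Nat.gcd g (Nat.lcm k₁ 1)) (D * c * u₁) =
      ramanujanSum (k₁ / Nat.gcd g (Nat.lcm k₁ 1)) (D * u₁) := fun hc => by
    rw [mul_right_comm, ramanujanSum_mul_natCast_of_coprime (hc.coprime_dvd_left (Nat.div_dvd_of_dvd hg₁))]
  rw [e, e, classGcdSum_one hk₁, classGcdSum_one hk₁, if_pos hg₁, if_pos hg₁, hram ha, hram hb,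
    classGcdSum_congr_intModEq m r (((Int.natCast_modEq_iff.mpr hab).mul_left D).mul_right u₂)
      (Nat.gcd g (Nat.lcm k₂ m))]

/-- **Fibrewise class uniformity with a third factor of modulus prime to `q`.** Under the hypotheses of
`sum_fibre_classWeightedSum_mul_eq`, for any `W₃`, `D₃ ∈ ℤ`, modulus `m` with `q ∤ m` and class `r₃ (mod m)`, the
fibre sums of `classWeightedSum W₁ (2q) r k (D₁q^v a) · classWeightedSum W₂ (2q) s k (D₂a) · classWeightedSum W₃ m r₃ k (D₃a)`
do not depend on the unit classes `(r, s)` (the third factor is constant on the fibre). [folklore] -/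
theorem sum_fibre_classWeightedSum_mul_mul_eq {q : ℕ} (hq : q.Prime) (hq2 : q ≠ 2) {j k' : ℕ} (hk' : k' ≠ 0)
    (hqk' : ¬ q ∣ k') {v : ℕ} (hv : 1 ≤ v) (D₁ : ℤ) {D₂ : ℤ} (hD₂ : ¬ (q : ℤ) ∣ D₂) (D₃ : ℤ)
    (W₁ W₂ W₃ : ℕ → ℂ) {m : ℕ} (hm : ¬ q ∣ m) (r₃ : ℕ) {r s r' s' : ℕ} (hr : r.Coprime (2 * q))
    (hs : s.Coprime (2 * q)) (hr' : r'.Coprime (2 * q)) (hs' : s'.Coprime (2 * q)) (a₂ : ℕ) :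
    ∑ a ∈ (Finset.range (q ^ j * k')).filter (fun a => Nat.Coprime (q ^ j * k') a ∧ a ≡ a₂ [MOD k']),
        classWeightedSum W₁ (2 * q) r (q ^ j * k') (D₁ * q ^ v * a) *
          classWeightedSum W₂ (2 * q) s (q ^ j * k') (D₂ * a) * classWeightedSum W₃ m r₃ (q ^ j * k') (D₃ * a) =
      ∑ a ∈ (Finset.range (q ^ j * k')).filter (fun a => Nat.Coprime (q ^ j * k') a ∧ a ≡ a₂ [MOD k']),
        classWeightedSum W₁ (2 * q) r' (q ^ j * k') (D₁ * q ^ v * a) *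
          classWeightedSum W₂ (2 * q) s' (q ^ j * k') (D₂ * a) * classWeightedSum W₃ m r₃ (q ^ j * k') (D₃ * a) := by
  rcases ((Finset.range (q ^ j * k')).filter
      (fun a => Nat.Coprime (q ^ j * k') a ∧ a ≡ a₂ [MOD k'])).eq_empty_or_nonempty with h0 | ⟨a₀, ha₀⟩
  · rw [h0, Finset.sum_empty, Finset.sum_empty]
  obtain ⟨-, hka₀, hma₀⟩ := Finset.mem_filter.mp ha₀
  have hcop : (q ^ j).Coprime (k' * m) :=
    Nat.Coprime.pow_left j (Nat.Coprime.mul_right ((Nat.Prime.coprime_iff_not_dvd hq).mpr hqk')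
      ((Nat.Prime.coprime_iff_not_dvd hq).mpr hm))
  refine sum_mul_eq_sum_mul_of_const (fun a => classWeightedSum W₃ m r₃ (q ^ j * k') (D₃ * a))
    (c := classWeightedSum W₃ m r₃ (q ^ j * k') (D₃ * a₀)) (fun a ha => ?_)
    (sum_fibre_classWeightedSum_mul_eq hq hq2 hk' hqk' hv D₁ hD₂ W₁ W₂ hr hs hr' hs' a₂)
  obtain ⟨-, hka, hma⟩ := Finset.mem_filter.mp ha
  exact classWeightedSum_mul_natCast_eq_of_modEq (pow_ne_zero j hq.ne_zero) hk' hcop W₃ r₃ D₃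
    (hka.coprime_dvd_left (dvd_mul_right (q ^ j) k')) (hka₀.coprime_dvd_left (dvd_mul_right (q ^ j) k'))
    (hma.trans hma₀.symm)

/-- The case of a FREE third factor (`m = 1`). [folklore] -/
theorem sum_fibre_classWeightedSum_mul_mul_one_eq {q : ℕ} (hq : q.Prime) (hq2 : q ≠ 2) {j k' : ℕ} (hk' : k' ≠ 0)
    (hqk' : ¬ q ∣ k') {v : ℕ} (hv : 1 ≤ v) (D₁ : ℤ) {D₂ : ℤ} (hD₂ : ¬ (q : ℤ) ∣ D₂) (D₃ : ℤ)
    (W₁ W₂ W₃ : ℕ → ℂ) (r₃ : ℕ) {r s r' s' : ℕ} (hr : r.Coprime (2 * q)) (hs : s.Coprime (2 * q))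
    (hr' : r'.Coprime (2 * q)) (hs' : s'.Coprime (2 * q)) (a₂ : ℕ) :
    ∑ a ∈ (Finset.range (q ^ j * k')).filter (fun a => Nat.Coprime (q ^ j * k') a ∧ a ≡ a₂ [MOD k']),
        classWeightedSum W₁ (2 * q) r (q ^ j * k') (D₁ * q ^ v * a) *
          classWeightedSum W₂ (2 * q) s (q ^ j * k') (D₂ * a) * classWeightedSum W₃ 1 r₃ (q ^ j * k') (D₃ * a) =
      ∑ a ∈ (Finset.range (q ^ j * k')).filter (fun a => Nat.Coprime (q ^ j * k') a ∧ a ≡ a₂ [MOD k']),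
        classWeightedSum W₁ (2 * q) r' (q ^ j * k') (D₁ * q ^ v * a) *
          classWeightedSum W₂ (2 * q) s' (q ^ j * k') (D₂ * a) * classWeightedSum W₃ 1 r₃ (q ^ j * k') (D₃ * a) :=
  sum_fibre_classWeightedSum_mul_mul_eq hq hq2 hk' hqk' hv D₁ hD₂ D₃ W₁ W₂ W₃
    (fun h => hq.ne_one (Nat.dvd_one.mp h)) r₃ hr hs hr' hs' a₂

/-- The case of a PARITY-ONLY third factor (`m = 2`, odd class). [folklore] -/
theorem sum_fibre_classWeightedSum_mul_mul_two_eq {q : ℕ} (hq : q.Prime) (hq2 : q ≠ 2) {j k' : ℕ} (hk' : k' ≠ 0)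
    (hqk' : ¬ q ∣ k') {v : ℕ} (hv : 1 ≤ v) (D₁ : ℤ) {D₂ : ℤ} (hD₂ : ¬ (q : ℤ) ∣ D₂) (D₃ : ℤ)
    (W₁ W₂ W₃ : ℕ → ℂ) {r s r' s' : ℕ} (hr : r.Coprime (2 * q)) (hs : s.Coprime (2 * q))
    (hr' : r'.Coprime (2 * q)) (hs' : s'.Coprime (2 * q)) (a₂ : ℕ) :
    ∑ a ∈ (Finset.range (q ^ j * k')).filter (fun a => Nat.Coprime (q ^ j * k') a ∧ a ≡ a₂ [MOD k']),
        classWeightedSum W₁ (2 * q) r (q ^ j * k') (D₁ * q ^ v * a) *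
          classWeightedSum W₂ (2 * q) s (q ^ j * k') (D₂ * a) * classWeightedSum W₃ 2 1 (q ^ j * k') (D₃ * a) =
      ∑ a ∈ (Finset.range (q ^ j * k')).filter (fun a => Nat.Coprime (q ^ j * k') a ∧ a ≡ a₂ [MOD k']),
        classWeightedSum W₁ (2 * q) r' (q ^ j * k') (D₁ * q ^ v * a) *
          classWeightedSum W₂ (2 * q) s' (q ^ j * k') (D₂ * a) * classWeightedSum W₃ 2 1 (q ^ j * k') (D₃ * a) :=
  sum_fibre_classWeightedSum_mul_mul_eq hq hq2 hk' hqk' hv D₁ hD₂ D₃ W₁ W₂ W₃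
    (fun h => hq2 ((Nat.prime_dvd_prime_iff_eq hq Nat.prime_two).mp h)) 1 hr hs hr' hs' a₂

/-- **Triple products over unions of fibres, arbitrary modulus.** For an odd prime `q`, `k ≥ 1`, `k' = k/q^{v_q(k)}`,
`v ≥ 1`, `q ∤ D₂`, `q ∤ m`, any `D₁, D₃, W₁, W₂, W₃, r₃`, unit classes mod `2q` and a `k'`-periodic predicate `P`:
`Σ_{a < k, (a,k)=1, P(a)} classWeightedSum W₁ (2q) r k (D₁q^v a) · classWeightedSum W₂ (2q) s k (D₂a) · classWeightedSum W₃ m r₃ k (D₃a)`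
does not depend on `(r, s)`. [folklore] -/
theorem sum_filter_coprime_classWeightedSum_mul_mul_eq_of_periodic {q : ℕ} (hq : q.Prime) (hq2 : q ≠ 2) {k : ℕ}
    (hk : k ≠ 0) {v : ℕ} (hv : 1 ≤ v) (D₁ : ℤ) {D₂ : ℤ} (hD₂ : ¬ (q : ℤ) ∣ D₂) (D₃ : ℤ) (W₁ W₂ W₃ : ℕ → ℂ)
    {m : ℕ} (hm : ¬ q ∣ m) (r₃ : ℕ) (P : ℕ → Prop) [DecidablePred P]
    (hP : ∀ a b, a ≡ b [MOD k / q ^ k.factorization q] → (P a ↔ P b)) {r s r' s' : ℕ} (hr : r.Coprime (2 * q))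
    (hs : s.Coprime (2 * q)) (hr' : r'.Coprime (2 * q)) (hs' : s'.Coprime (2 * q)) :
    ∑ a ∈ (Finset.range k).filter (fun a => Nat.Coprime k a ∧ P a),
        classWeightedSum W₁ (2 * q) r k (D₁ * q ^ v * a) * classWeightedSum W₂ (2 * q) s k (D₂ * a) *
          classWeightedSum W₃ m r₃ k (D₃ * a) =
      ∑ a ∈ (Finset.range k).filter (fun a => Nat.Coprime k a ∧ P a),
        classWeightedSum W₁ (2 * q) r' k (D₁ * q ^ v * a) * classWeightedSum W₂ (2 * q) s' k (D₂ * a) *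
          classWeightedSum W₃ m r₃ k (D₃ * a) := by
  have e : q ^ k.factorization q * (k / q ^ k.factorization q) = k := Nat.ordProj_mul_ordCompl_eq_self k q
  have hk' : k / q ^ k.factorization q ≠ 0 := fun h0 => hk (by rw [← e, h0, mul_zero])
  rw [← e]
  exact sum_filter_coprime_eq_of_fibres hk' P hP fun b =>
    sum_fibre_classWeightedSum_mul_mul_eq hq hq2 hk' (Nat.not_dvd_ordCompl hq hk) hv D₁ hD₂ D₃ W₁ W₂ W₃ hm r₃
      hr hs hr' hs' b

/-- **Vanishing of the triple products for `q² ∣ k`** over any set of units `{a < k : (a,k)=1, P(a)}` (any first and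
third factors `Φ, Ψ`; `q ∤ D₂`, `(s, 2q) = 1`). [folklore] -/
theorem sum_filter_coprime_mul_classWeightedSum_mul_eq_zero {q : ℕ} (hq : q.Prime) (hq2 : q ≠ 2) {k : ℕ}
    (hqk : q ^ 2 ∣ k) (Φ Ψ : ℕ → ℂ) {D₂ : ℤ} (hD₂ : ¬ (q : ℤ) ∣ D₂) (W₂ : ℕ → ℂ) (P : ℕ → Prop) [DecidablePred P]
    {s : ℕ} (hs : s.Coprime (2 * q)) :
    ∑ a ∈ (Finset.range k).filter (fun a => Nat.Coprime k a ∧ P a),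
      Φ a * classWeightedSum W₂ (2 * q) s k (D₂ * a) * Ψ a = 0 := by
  refine Finset.sum_eq_zero fun a ha => ?_
  rw [classWeightedSum_eq_zero_of_sq_dvd_of_coprime hq hq2 hqk (hs.coprime_dvd_right (dvd_mul_left q 2)) hD₂
    (Finset.mem_filter.mp ha).2.1 W₂, mul_zero, zero_mul]

end SmoothArcs

end Literature.NumberTheory.Sieve

end
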